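import Summits.SmoothPoincare4.SmoothPoincare4.Theorems.ConvexBisectionContractibleTwistedDoubleStandardStubSeam
import Summits.SmoothPoincare4.SmoothPoincare4.Theorems.ConvexBisectionAcyclicBisectionRigiditySeamGluing
import Summits.SmoothPoincare4.SmoothPoincare4.Theorems.ConvexBisectionAcyclicBisectionRigiditySeamGluingTransport
import Literature.Barriers.SmoothPoincare4.ExoticContractibleSymmetryKillingCore
import Literature.Geometry.Symplectic.SteinOrientation
import Literature.Geometry.Symplectic.SteinBoundaryContactProofs
import Literature.Topology.FourManifolds.HeegaardSplittingRealizationProofs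
import Literature.Topology.FourManifolds.SphereFourOneZeroOneSplitting
import Literature.Topology.FourManifolds.SpinDiffeomorphProofs
import Literature.Topology.FourManifolds.GluingProofs
import Literature.Topology.FourManifolds.Cobordism
import HarnessLib

/-!
# A contact Stein bisection of a closed `4`-manifold by contractible halves is orientable; the bet of
line `property-r-mazur-halves` is implied by the crux's conclusion
(stub `stub_bisectionOrientable` of skeleton m7, crux `ConvexBisection.ContractibleTwistedDoubleStandard`, item stmt-SmoothPoincare4-3546)

* `stub_bisectionOrientable` — for a crux bisection `X = e₁(W₁) ∪ e₂(W₂)` (two compact contractible Stein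
  domains, smoothly embedded, covering `X`, meeting exactly along both boundary images, contact planes
  matched), `X` is orientable: the seam map `ψ : ∂W₁ ≅ ∂W₂` of the landed `stub_seam` presents `X` as
  the boundary gluing `W₁ ∪_ψ W₂` (`SeamGluing.isBoundaryGluing_of_bisection`); the boundary of the
  compact contractible `W₁` is connected (Lefschetz duality mod 2,
  `connectedSpace_boundaryCarrier_of_contractibleSpace`); the halves carry their complex orientations
  (`SteinStructure.isOrientable`); so the model gluing is orientable
  (`exists_isBoundaryGluingWith_connected_isOrientable`, Hirsch 4.4) and `X` is diffeomorphic to it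
  (uniqueness of gluings, Hirsch 8.2.1).
* `oneZeroOneOneOne_of_nonempty_diffeomorph_sphere` — TIGHTNESS CERTIFICATE for the line's bet (m7 form:
  "`X` carries a Morse function of profile `(1,0,1,1,1)`"): every `4`-manifold diffeomorphic to `S⁴`
  carries such a function (the tree's `exists_isMorse_sphereFour_twoThree` — the height function with one
  `(2,3)` birth pair — pulled back along the diffeomorphism).  So on its sector the bet is EQUIVALENT to
  the crux's conclusion `X ≅ S⁴` (the converse is `stub_closedOneZeroOne`, modulo Property R +
  Laudenbach–Poénaru): it is SPC4-implied and not cheaply refutable.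

References: M. W. Hirsch, *Differential Topology* (1976), Ch. 4 §4, Ch. 8 §2 Thm. 2.1; A. Hatcher,
*Algebraic Topology* (2002), Thm. 3.43; J. Milnor, *Lectures on the h-cobordism theorem* (1965), Lemma 8.2.
-/

noncomputable section

-- the prescribed namespace `Summit.<P>.<Sub>.…` duplicates `SmoothPoincare4` (P = Sub)
set_option linter.dupNamespace false

open scoped Manifold ContDiff Topology
open Set Function Literature.Topology.FourManifolds Literature.Geometry.Symplectic

namespace Summit.SmoothPoincare4.SmoothPoincare4.Theorems.ContractibleTwistedDoubleStandard.PropertyRMazurHalves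

/-- **Stub `stub_bisectionOrientable` (skeleton m7, PROVED): a contact Stein bisection of a closed
`4`-manifold by two compact contractible Stein domains is orientable.**  Gluing of the orientable
halves (complex orientations) along the connected boundary of a contractible compact `4`-manifold,
plus uniqueness of gluings. [cite: HirschDT1976, Ch. 4 §4 and Ch. 8 §2, Thm. 2.1] [cite: HatcherAT2002, §3.3 Thm. 3.43] -/
theorem stub_bisectionOrientable :
    ∀ (X : Type) [TopologicalSpace X] [T2Space X] [SecondCountableTopology X] [CompactSpace X]
      [ChartedSpace (EuclideanSpace ℝ (Fin 4)) X] [IsManifold (𝓡 4) ∞ X]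
      (W₁ : Type) [TopologicalSpace W₁] [ChartedSpace (EuclideanHalfSpace 4) W₁]
      [IsManifold (𝓡∂ 4) ∞ W₁] [CompactSpace W₁] [ContractibleSpace W₁]
      (W₂ : Type) [TopologicalSpace W₂] [ChartedSpace (EuclideanHalfSpace 4) W₂]
      [IsManifold (𝓡∂ 4) ∞ W₂] [CompactSpace W₂] [ContractibleSpace W₂]
      (J₁ : SteinStructure W₁) (J₂ : SteinStructure W₂) (e₁ : W₁ → X) (e₂ : W₂ → X),
      Manifold.IsSmoothEmbedding (𝓡∂ 4) (𝓡 4) ∞ e₁ → Manifold.IsSmoothEmbedding (𝓡∂ 4) (𝓡 4) ∞ e₂ →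
      Set.range e₁ ∪ Set.range e₂ = Set.univ →
      Set.range e₁ ∩ Set.range e₂ = e₁ '' (𝓡∂ 4).boundary W₁ →
      Set.range e₁ ∩ Set.range e₂ = e₂ '' (𝓡∂ 4).boundary W₂ →
      (∀ w₁ w₂, e₁ w₁ = e₂ w₂ →
        Submodule.map (mfderiv (𝓡∂ 4) (𝓡 4) e₁ w₁).toLinearMap (contactPlane J₁.J w₁) =
          Submodule.map (mfderiv (𝓡∂ 4) (𝓡 4) e₂ w₂).toLinearMap (contactPlane J₂.J w₂)) →
      IsOrientable (𝓡 4) X := by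
  intro X _ _ _ _ _ _ W₁ _ _ _ _ _ W₂ _ _ _ _ _ J₁ J₂ e₁ e₂ h1 h2 hcov hL hR hC
  haveI : T2Space W₁ := h1.isEmbedding.t2Space
  haveI : T2Space W₂ := h2.isEmbedding.t2Space
  haveI : SecondCountableTopology W₁ := h1.isEmbedding.secondCountableTopology
  haveI : SecondCountableTopology W₂ := h2.isEmbedding.secondCountableTopology
  haveI : ConnectedSpace W₁ := inferInstance
  haveI : ConnectedSpace W₂ := inferInstance
  haveI : Nonempty W₁ := inferInstance
  obtain ⟨b₁⟩ := nonempty_boundaryData_holds 3 W₁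
  obtain ⟨b₂⟩ := nonempty_boundaryData_holds 3 W₂
  obtain ⟨ψ, hψ, -⟩ := LegendrianRKnotRigidity.stub_seam X W₁ W₂ J₁ J₂ e₁ e₂ h1 h2 hL hR hC b₁ b₂
  haveI : ConnectedSpace b₁.carrier :=
    Literature.Barriers.SmoothPoincare4.connectedSpace_boundaryCarrier_of_contractibleSpace (n := 2) b₁
  obtain ⟨X₀, _, _, _, _, _, _, _, hX₀o, jM, jN, hW⟩ :=
    exists_isBoundaryGluingWith_connected_isOrientable (n := 3) J₁.isOrientable J₂.isOrientable b₁ b₂ ψ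
  have hg : IsBoundaryGluing b₁ b₂ ψ (𝓡 4) X :=
    AcyclicBisectionRigidity.SeamGluing.isBoundaryGluing_of_bisection h1 h2 hcov hL b₁ b₂ ψ hψ
  obtain ⟨Φ⟩ := nonempty_diffeomorph_of_isBoundaryGluing_holds hW.isBoundaryGluing hg
  exact hX₀o.of_diffeomorph Φ (by simp)

/-- **Tightness of the bet: a `4`-manifold diffeomorphic to `S⁴` carries a Morse function of profile
`(1,0,1,1,1)`** — the round sphere does (`exists_isMorse_sphereFour_twoThree`: height function plus one
`(2,3)` birth pair, Milnor 1965 Lemma 8.2), and Morse functions with their critical data pull back along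
diffeomorphisms (`SeamGluing.IsMorse.comp_diffeomorph`, `SeamGluing.ncard_criticalSetOfIndex_comp_diffeomorph`).
So the m7 bet `stub_mazurSectorCancellation` is implied by the crux's conclusion on its sector.
[cite: MilnorHCobordism1965, Lemma 8.2] [cite: Milnor1963, §2 and §6] -/
theorem oneZeroOneOneOne_of_nonempty_diffeomorph_sphere (X : Type) [TopologicalSpace X]
    [ChartedSpace (EuclideanSpace ℝ (Fin 4)) X] [IsManifold (𝓡 4) ∞ X]
    (h : Nonempty (X ≃ₘ⟮𝓡 4, 𝓡 4⟯ Metric.sphere (0 : EuclideanSpace ℝ (Fin 5)) 1)) :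
    ∃ G : X → ℝ, IsMorse (𝓡 4) G ∧
      (criticalSetOfIndex (𝓡 4) G 0).ncard = 1 ∧ (criticalSetOfIndex (𝓡 4) G 1).ncard = 0 ∧
      (criticalSetOfIndex (𝓡 4) G 2).ncard = 1 ∧ (criticalSetOfIndex (𝓡 4) G 3).ncard = 1 ∧
      (criticalSetOfIndex (𝓡 4) G 4).ncard = 1 := by
  obtain ⟨Φ⟩ := h
  obtain ⟨f, -, hf, -, h0, h1, h2, h3, h4, -, -⟩ := exists_isMorse_sphereFour_twoThree
  refine ⟨f ∘ Φ, AcyclicBisectionRigidity.SeamGluing.IsMorse.comp_diffeomorph Φ hf, ?_, ?_, ?_, ?_, ?_⟩ <;>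
    rw [AcyclicBisectionRigidity.SeamGluing.ncard_criticalSetOfIndex_comp_diffeomorph Φ hf.contMDiff]
  exacts [h0, h1, h2, h3, h4]

end Summit.SmoothPoincare4.SmoothPoincare4.Theorems.ContractibleTwistedDoubleStandard.PropertyRMazurHalves

end
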